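import Mathlib
import Literature.Analysis.FluidPDE.VectorCalculus
import Literature.Analysis.ODE.GlobalExistence

/-!
# Route `FilamentSkeletonRss` · crux `SelectionBoxRJ` (stmt-NavierStokesRegularity-21220) — rung tools (R1, existence side):
# global shooting for the local-induction filament equation with a CUT-OFF and a position-dependent forcing

Lane `ns-filament-19175-p1` (g7), director-ns ORDER OF WORK l.3062 (B)(iii) (bc5 rung duty), rung ladder of
`RUNG-SIZING-21220.md` / `SIGMA-SCALING-21220.md` (item evidence on stmt-21220).  Helper file
`--supports stmt-NavierStokesRegularity-21220`; route-independent (no `Theses` import).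

WHAT.  The tree's `SkeletonEquilibrium.Sketch.stub_forcedShooting` solves `X″ = η X′ × (A X + U t)` globally for a CONSTANT
coefficient `η` and a forcing frozen along the parameter.  The model rung R1 (the cut-off local-induction arc glued to
straight arms, file `…RungModelArc`) needs the coefficient switched off smoothly outside the tangency ball, and the later rungs
need forcings evaluated at the moving point.  This file proves the general statement covering all of these:

* `cutoffShooting_exists` / `cutoffShooting_unique` — for a real inner-product space `F` (finite-dimensional), a continuous
  bilinear `B : F → F → F` with `⟪B w v, w⟫ = 0`, and a forcing `g : ℝ → F → F` that is jointly `C¹` in `(t, x)`, the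
  equation `X″ t = B (X′ t) (g t (X t))` has, for all Cauchy data `(P, e)` with `‖e‖ = 1`, a global `C²` UNIT-SPEED solution
  on `ℝ`, unique among `C²` curves with the same data;
* `cutoffLia_exists` / `cutoffLia_unique` — the specialisation `X″ t = c t • X′ t × F t (X t)` on `ℝ³` (`c : ℝ → ℝ` and
  `F : ℝ → ℝ³ → ℝ³` jointly `C¹`), which is the cut-off local-induction model (`c = η χ`, `F t y = ½ y − α e₃ × y + U t`
  or `+ U(y)`).

Proof: verbatim the phase-space argument of `stub_forcedShooting` (adapted from
`Theorems/FilamentSkeletonRssSkeletonEquilibriumForcedShooting.lean`): the field `(t, (x, w)) ↦ (w, B w (g t x))` is `C¹`,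
hence Lipschitz on balls uniformly on compact time intervals; `‖w‖` is conserved, so `‖x t‖ ≤ ‖P‖ + t`; the tree's
continuation principle `Literature.Analysis.ODE.exists_solution_of_apriori_bound` gives `[0, ∞)`, time reversal gives
`(−∞, 0]`, glue at `0`; uniqueness is Grönwall's.

HONEST FRAMING.  ODE bookkeeping for the MODEL rung of a HYPOTHETICAL filament box; nothing here is a claim about
Navier–Stokes regularity or blow-up.
-/

set_option linter.dupNamespace false -- `Theorems.…Theorems`-style path/namespace repetition is the tree convention

noncomputable section

namespace Summit.NavierStokesRegularity.NavierStokesRegularity.Theorems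

open Set Metric Filter Topology Function
open Literature.Analysis.FluidPDE Literature.Analysis.ODE
open scoped RealInnerProductSpace InnerProductSpace NNReal

namespace SelectionBoxRJRung

namespace CutoffShooting

variable {F : Type*} [NormedAddCommGroup F] [InnerProductSpace ℝ F]

/-- The phase-space field `((x, w), t) ↦ (w, B w (g t x))` of the cut-off filament equation is Lipschitz on every ball,
uniformly for `t` in a compact interval: it is `C¹` jointly in `((x, w), t)` when `g` is jointly `C¹`, so its derivative
is bounded on the compact convex set `B̄(0, ρ) × [−T, T]` and the mean value inequality applies. [folklore] -/
theorem lipschitz_field [ProperSpace F] (B : F →L[ℝ] F →L[ℝ] F) {g : ℝ → F → F}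
    (hg : ContDiff ℝ 1 (fun q : ℝ × F => g q.1 q.2)) (T ρ : ℝ) :
    ∃ K : ℝ≥0, ∀ t ∈ Icc (-T) T,
      LipschitzOnWith K (fun p : F × F => (p.2, B p.2 (g t p.1))) (closedBall 0 ρ) := by
  have hcomp : ContDiff ℝ 1 (fun q : (F × F) × ℝ => g q.2 q.1.1) :=
    hg.comp (by fun_prop : ContDiff ℝ 1 (fun q : (F × F) × ℝ => (q.2, q.1.1)))
  have hΦ : ContDiff ℝ 1 (fun q : (F × F) × ℝ => (q.1.2, B q.1.2 (g q.2 q.1.1))) := by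
    refine ContDiff.prodMk (by fun_prop) ?_
    exact (B.contDiff.comp (by fun_prop : ContDiff ℝ 1 (fun q : (F × F) × ℝ => q.1.2))).clm_apply hcomp
  have hS : IsCompact (closedBall (0 : F × F) ρ ×ˢ Icc (-T) T) :=
    (isCompact_closedBall _ _).prod isCompact_Icc
  obtain ⟨C, hC⟩ := hS.exists_bound_of_continuousOn
    (hΦ.continuous_fderiv one_ne_zero).continuousOn
  have hL := Convex.lipschitzOnWith_of_nnnorm_fderiv_le (𝕜 := ℝ) (C := Real.toNNReal C)
    (fun q _ => hΦ.differentiable one_ne_zero q)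
    (fun q hq => by
      rw [← NNReal.coe_le_coe, coe_nnnorm]
      exact (hC q hq).trans (Real.le_coe_toNNReal C))
    ((convex_closedBall _ _).prod (convex_Icc _ _))
  refine ⟨Real.toNNReal C, fun t ht => LipschitzOnWith.of_dist_le_mul fun p hp q hq => ?_⟩
  have h := hL.dist_le_mul (p, t) ⟨hp, ht⟩ (q, t) ⟨hq, ht⟩
  rwa [@Prod.dist_eq _ _ _ _ (p, t) (q, t), dist_self, max_eq_left dist_nonneg] at h

/-- **A priori bounds.** Along any solution `(x, w)` on `[0, s]` of `x' = w`, `w' = B w (g t x)` with `⟪B w v, w⟫ = 0`,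
issued from `(P, e)` with `‖e‖ = 1`: the speed is conserved, `‖w t‖ = 1`, and `‖x t‖ ≤ ‖P‖ + t`. [folklore] -/
theorem apriori {B : F →L[ℝ] F →L[ℝ] F} (hB : ∀ w v, ⟪B w v, w⟫ = 0) {g : ℝ → F → F}
    {P e : F} (he : ‖e‖ = 1) {s : ℝ} {γ : ℝ → F × F} (h0 : γ 0 = (P, e))
    (hγ : ∀ t ∈ Icc 0 s,
      HasDerivWithinAt γ ((γ t).2, B (γ t).2 (g t (γ t).1)) (Icc 0 s) t) :
    ∀ t ∈ Icc 0 s, ‖(γ t).2‖ = 1 ∧ ‖(γ t).1‖ ≤ ‖P‖ + t := by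
  have h1 : ∀ t ∈ Icc 0 s, HasDerivWithinAt (fun τ => (γ τ).1) (γ t).2 (Icc 0 s) t :=
    fun t ht => (ContinuousLinearMap.fst ℝ F F).hasFDerivAt.comp_hasDerivWithinAt t (hγ t ht)
  have h2 : ∀ t ∈ Icc 0 s,
      HasDerivWithinAt (fun τ => (γ τ).2) (B (γ t).2 (g t (γ t).1)) (Icc 0 s) t :=
    fun t ht => (ContinuousLinearMap.snd ℝ F F).hasFDerivAt.comp_hasDerivWithinAt t (hγ t ht)
  have hsq : ∀ t ∈ Icc 0 s, HasDerivWithinAt (fun τ => ‖(γ τ).2‖ ^ 2) 0 (Icc 0 s) t := by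
    intro t ht
    refine (h2 t ht).norm_sq.congr_deriv ?_
    rw [real_inner_comm, hB, mul_zero]
  have hunit : ∀ t ∈ Icc 0 s, ‖(γ t).2‖ = 1 := by
    intro t ht
    have h := norm_image_sub_le_of_norm_deriv_le_segment' (f' := fun _ => (0 : ℝ)) (C := 0) hsq
      (fun _ _ => norm_zero.le) t ht
    simp only [zero_mul, norm_le_zero_iff, sub_eq_zero, h0, he, one_pow] at h
    exact (pow_left_inj₀ (norm_nonneg _) zero_le_one two_ne_zero).1 (by rw [h, one_pow])
  refine fun t ht => ⟨hunit t ht, ?_⟩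
  have h := norm_image_sub_le_of_norm_deriv_le_segment' (C := 1) h1
    (fun τ hτ => (hunit τ (Ico_subset_Icc_self hτ)).le) t ht
  simp only [h0, sub_zero, one_mul] at h
  calc ‖(γ t).1‖ = ‖((γ t).1 - P) + P‖ := by rw [sub_add_cancel]
    _ ≤ ‖(γ t).1 - P‖ + ‖P‖ := norm_add_le _ _
    _ ≤ ‖P‖ + t := by linarith

/-- **Forward global existence** on `[0, ∞)` for the phase-space system `x' = w`, `w' = B w (g t x)` (`⟪B w v, w⟫ = 0`,
`g` jointly `C¹`) from any `(P, e)` with `‖e‖ = 1`, by the continuation principle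
`Literature.Analysis.ODE.exists_solution_of_apriori_bound`. [folklore] -/
theorem exists_forward [ProperSpace F] {B : F →L[ℝ] F →L[ℝ] F}
    (hB : ∀ w v, ⟪B w v, w⟫ = 0) {g : ℝ → F → F} (hg : ContDiff ℝ 1 (fun q : ℝ × F => g q.1 q.2)) (P : F)
    {e : F} (he : ‖e‖ = 1) :
    ∃ γ : ℝ → F × F, γ 0 = (P, e) ∧ ∀ T, ∀ t ∈ Icc 0 T,
      HasDerivWithinAt γ ((γ t).2, B (γ t).2 (g t (γ t).1)) (Icc 0 T) t := by
  have hgc : Continuous (fun q : ℝ × F => g q.1 q.2) := hg.continuous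
  refine exists_solution_of_apriori_bound
    (v := fun t (p : F × F) => (p.2, B p.2 (g t p.1))) ?_ ?_ ?_
  · intro T ρ
    obtain ⟨K, hK⟩ := lipschitz_field B hg T ρ
    exact ⟨K, fun t ht => hK t ⟨by linarith [ht.1, ht.2], ht.2⟩⟩
  · intro p
    have : Continuous fun t : ℝ => g t p.1 := hgc.comp (by fun_prop : Continuous fun t : ℝ => (t, p.1))
    exact (continuous_const.prodMk ((B p.2).continuous.comp this)).continuousOn
  · intro T hT
    refine ⟨‖P‖ + T + 1, ?_, fun s hs γ h0 hγ t ht => ?_⟩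
    · rw [Prod.norm_mk, he]
      exact max_le (by linarith) (by linarith [norm_nonneg P])
    · obtain ⟨hw, hx⟩ := apriori hB he h0 hγ t ht
      rw [Prod.norm_def, hw]
      exact max_le (by linarith [ht.2, hs.2]) (by linarith [norm_nonneg P])

/-- **Time reversal.** If `β = (x, w)` solves the system with parameters `(-B, g(-·, ·))` on `[0, T]`, then
`s ↦ (x(-s), -w(-s))` solves the system with parameters `(B, g)` on `[-T, 0]`. [folklore] -/
theorem reverse {B : F →L[ℝ] F →L[ℝ] F} {g : ℝ → F → F} {T : ℝ}
    {β : ℝ → F × F} (hβ : ∀ τ ∈ Icc 0 T,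
      HasDerivWithinAt β ((β τ).2, (-B) (β τ).2 (g (-τ) (β τ).1)) (Icc 0 T) τ) :
    ∀ t ∈ Icc (-T) 0, HasDerivWithinAt (fun s => (((β (-s)).1, -(β (-s)).2) : F × F))
      (-(β (-t)).2, B (-(β (-t)).2) (g t (β (-t)).1)) (Icc (-T) 0) t := by
  intro t ht
  have hmaps : MapsTo Neg.neg (Icc (-T) 0) (Icc 0 T) := fun s hs =>
    ⟨neg_nonneg.2 hs.2, neg_le.2 hs.1⟩
  set L : F × F →L[ℝ] F × F :=
    (ContinuousLinearMap.fst ℝ F F).prod (-ContinuousLinearMap.snd ℝ F F) with hL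
  have h1 := (hβ (-t) (hmaps ht)).scomp t (hasDerivAt_neg t).hasDerivWithinAt hmaps
  have h2 := L.hasFDerivAt.comp_hasDerivWithinAt t h1
  have hfun : (fun s => (((β (-s)).1, -(β (-s)).2) : F × F)) = L ∘ (β ∘ Neg.neg) := by
    funext s
    simp [hL]
  rw [hfun]
  refine h2.congr_deriv ?_
  simp [hL]

/-- **Two-sided global phase curve.** For `g` jointly `C¹`, `⟪B w v, w⟫ = 0` and `‖e‖ = 1` there is a global phase curve
`γ = (x, w) : ℝ → F × F` with `γ 0 = (P, e)`, `‖w‖ ≡ 1`, and `γ' t = (w, B w (g t x))` at every `t`. [folklore] -/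
theorem exists_phase [ProperSpace F] {B : F →L[ℝ] F →L[ℝ] F}
    (hB : ∀ w v, ⟪B w v, w⟫ = 0) {g : ℝ → F → F} (hg : ContDiff ℝ 1 (fun q : ℝ × F => g q.1 q.2)) (P : F)
    {e : F} (he : ‖e‖ = 1) :
    ∃ γ : ℝ → F × F, γ 0 = (P, e) ∧ (∀ t, ‖(γ t).2‖ = 1) ∧
      ∀ t, HasDerivAt γ ((γ t).2, B (γ t).2 (g t (γ t).1)) t := by
  obtain ⟨α, hα0, hα⟩ := exists_forward hB hg P he
  have he' : ‖-e‖ = 1 := by rw [norm_neg, he]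
  have hB' : ∀ w v, ⟪(-B) w v, w⟫ = 0 := fun w v => by
    rw [_root_.neg_apply, _root_.neg_apply, inner_neg_left, hB, neg_zero]
  have hg' : ContDiff ℝ 1 (fun q : ℝ × F => g (-q.1) q.2) :=
    hg.comp (by fun_prop : ContDiff ℝ 1 (fun q : ℝ × F => (-q.1, q.2)))
  obtain ⟨β, hβ0, hβ⟩ := exists_forward hB' (g := fun t x => g (-t) x) hg' P he'
  set βr : ℝ → F × F := fun s => ((β (-s)).1, -(β (-s)).2) with hβr
  refine ⟨fun s => if s ≤ 0 then βr s else α s, by simp [hβr, hβ0], fun t => ?_, fun t => ?_⟩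
  · by_cases ht : t ≤ 0
    · simp only [if_pos ht, hβr, norm_neg]
      exact ((apriori hB' he' hβ0 (hβ (-t))) (-t) ⟨neg_nonneg.2 ht, le_rfl⟩).1
    · simp only [if_neg ht]
      exact ((apriori hB he hα0 (hα t)) t ⟨(not_le.1 ht).le, le_rfl⟩).1
  · have hT : 0 < |t| + 1 := by positivity
    have hsol := solution_append (v := fun t (p : F × F) => (p.2, B p.2 (g t p.1)))
      (reverse (hβ (|t| + 1))) (hα (|t| + 1)) (by linarith) hT.le (by simp [hβ0, hα0])
    exact solution_hasDerivAt (v := fun t (p : F × F) => (p.2, B p.2 (g t p.1))) hsol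
      ⟨by linarith [neg_abs_le t], by linarith [le_abs_self t]⟩

/-- **From a phase curve to a `C²` curve.** If `γ = (x, w)` has `γ' t = (w, B w (g t x))` at every `t`, with `g`
jointly continuous, then `x` is `C²`, `x' = w` and `x″ = B w (g t x)`. [folklore] -/
theorem curve_of_phase {B : F →L[ℝ] F →L[ℝ] F} {g : ℝ → F → F}
    (hgc : Continuous (fun q : ℝ × F => g q.1 q.2)) {γ : ℝ → F × F}
    (hγ : ∀ t, HasDerivAt γ ((γ t).2, B (γ t).2 (g t (γ t).1)) t) :
    ContDiff ℝ 2 (fun s => (γ s).1) ∧ deriv (fun s => (γ s).1) = (fun t => (γ t).2) ∧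
      ∀ t, deriv (deriv fun s => (γ s).1) t = B (γ t).2 (g t (γ t).1) := by
  have hγc : Continuous γ := continuous_iff_continuousAt.2 fun t => (hγ t).continuousAt
  have hXd : ∀ t, HasDerivAt (fun s => (γ s).1) (γ t).2 t := fun t =>
    (ContinuousLinearMap.fst ℝ F F).hasFDerivAt.comp_hasDerivAt t (hγ t)
  have hWd : ∀ t, HasDerivAt (fun s => (γ s).2) (B (γ t).2 (g t (γ t).1)) t := fun t =>
    (ContinuousLinearMap.snd ℝ F F).hasFDerivAt.comp_hasDerivAt t (hγ t)
  have hd1 : deriv (fun s => (γ s).1) = fun t => (γ t).2 := funext fun t => (hXd t).deriv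
  have hd2 : deriv (fun s => (γ s).2) = fun t => B (γ t).2 (g t (γ t).1) :=
    funext fun t => (hWd t).deriv
  have hgγ : Continuous fun t => g t (γ t).1 :=
    hgc.comp (continuous_id.prodMk (continuous_fst.comp hγc))
  have hBc : Continuous fun t => B (γ t).2 (g t (γ t).1) := by
    have h2c : Continuous fun t => (γ t).2 := continuous_snd.comp hγc
    exact ((B.continuous₂).comp (h2c.prodMk hgγ) : Continuous fun t => B (γ t).2 (g t (γ t).1))
  refine ⟨?_, hd1, fun t => by rw [hd1, hd2]⟩
  rw [show (2 : WithTop ℕ∞) = 1 + 1 from one_add_one_eq_two.symm, contDiff_succ_iff_deriv,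
    hd1, contDiff_one_iff_deriv, hd2]
  exact ⟨fun t => (hXd t).differentiableAt, by simp, fun t => (hWd t).differentiableAt, hBc⟩

/-- **Uniqueness.** Two `C²` curves with the same Cauchy data at `0` solving `Z″ = B Z′ (g t Z)` coincide (`g` jointly
`C¹`): their phase curves solve the same first-order system, whose field is Lipschitz on a ball containing both curves over
`[-T, T]`, so Grönwall uniqueness (`ODE_solution_unique_of_mem_Ioo`) applies. [folklore] -/
theorem unique_of_phase [ProperSpace F] {B : F →L[ℝ] F →L[ℝ] F} {g : ℝ → F → F}
    (hg : ContDiff ℝ 1 (fun q : ℝ × F => g q.1 q.2)) {X Y : ℝ → F} (hX : ContDiff ℝ 2 X) (hY : ContDiff ℝ 2 Y)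
    (h0 : X 0 = Y 0) (h0' : deriv X 0 = deriv Y 0)
    (hXo : ∀ t, deriv (deriv X) t = B (deriv X t) (g t (X t)))
    (hYo : ∀ t, deriv (deriv Y) t = B (deriv Y t) (g t (Y t))) : X = Y := by
  have key : ∀ {Z : ℝ → F}, ContDiff ℝ 2 Z →
      (∀ t, deriv (deriv Z) t = B (deriv Z t) (g t (Z t))) →
      (Continuous fun s => (Z s, deriv Z s)) ∧
      ∀ t, HasDerivAt (fun s => (Z s, deriv Z s)) (deriv Z t, B (deriv Z t) (g t (Z t))) t := by
    intro Z hZ hZo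
    have hd : Differentiable ℝ Z := hZ.differentiable two_ne_zero
    have hd2 : Differentiable ℝ (deriv Z) := hZ.differentiable_deriv_two
    exact ⟨hd.continuous.prodMk hd2.continuous, fun t =>
      ((hd t).hasDerivAt.prodMk (hd2 t).hasDerivAt).congr_deriv (by rw [hZo t])⟩
  obtain ⟨hXc, hXd⟩ := key hX hXo
  obtain ⟨hYc, hYd⟩ := key hY hYo
  funext t
  have hT0 : (0 : ℝ) ∈ Ioo (-(|t| + 1)) (|t| + 1) := ⟨by linarith [abs_nonneg t], by positivity⟩
  have htT : t ∈ Ioo (-(|t| + 1)) (|t| + 1) :=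
    ⟨by linarith [neg_abs_le t], by linarith [le_abs_self t]⟩
  obtain ⟨ρ₁, hρ₁⟩ := isCompact_Icc.exists_bound_of_continuousOn
    (hXc.continuousOn (s := Icc (-(|t| + 1)) (|t| + 1)))
  obtain ⟨ρ₂, hρ₂⟩ := isCompact_Icc.exists_bound_of_continuousOn
    (hYc.continuousOn (s := Icc (-(|t| + 1)) (|t| + 1)))
  obtain ⟨K, hK⟩ := lipschitz_field B hg (|t| + 1) (max ρ₁ ρ₂)
  have h := ODE_solution_unique_of_mem_Ioo
    (v := fun t (p : F × F) => (p.2, B p.2 (g t p.1)))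
    (s := fun _ => closedBall 0 (max ρ₁ ρ₂))
    (fun τ hτ => hK τ (Ioo_subset_Icc_self hτ)) hT0
    (fun τ hτ => ⟨hXd τ, mem_closedBall_zero_iff.2
      ((hρ₁ τ (Ioo_subset_Icc_self hτ)).trans (le_max_left _ _))⟩)
    (fun τ hτ => ⟨hYd τ, mem_closedBall_zero_iff.2
      ((hρ₂ τ (Ioo_subset_Icc_self hτ)).trans (le_max_right _ _))⟩)
    (by simp only [h0, h0']) htT
  exact congrArg Prod.fst h

end CutoffShooting

open CutoffShooting in
/-- **Global shooting with cut-off, general form (existence).**  `F` a finite-dimensional real inner-product space,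
`B : F → F → F` continuous bilinear with `⟪B w v, w⟫ = 0`, `g : ℝ → F → F` jointly `C¹`.  For all Cauchy data `(P, e)`
with `‖e‖ = 1` the equation `X″ t = B (X′ t) (g t (X t))` has a global `C²` solution on `ℝ` with `X 0 = P`, `X′ 0 = e` and
unit speed `‖X′ t‖ = 1`. [folklore] -/
theorem cutoffShooting_exists {F : Type*} [NormedAddCommGroup F] [InnerProductSpace ℝ F] [ProperSpace F]
    (B : F →L[ℝ] F →L[ℝ] F) (hB : ∀ w v, ⟪B w v, w⟫ = 0) {g : ℝ → F → F}
    (hg : ContDiff ℝ 1 (fun q : ℝ × F => g q.1 q.2)) (P : F) {e : F} (he : ‖e‖ = 1) :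
    ∃ X : ℝ → F, ContDiff ℝ 2 X ∧ X 0 = P ∧ deriv X 0 = e ∧ (∀ t, ‖deriv X t‖ = 1) ∧
      ∀ t, deriv (deriv X) t = B (deriv X t) (g t (X t)) := by
  obtain ⟨γ, h0, hunit, hγ⟩ := exists_phase hB hg P he
  obtain ⟨hC2, hd1, hdd⟩ := curve_of_phase hg.continuous hγ
  refine ⟨fun s => (γ s).1, hC2, by simp [h0], by rw [hd1]; simp [h0],
    fun t => by rw [hd1]; exact hunit t, fun t => ?_⟩
  have h := hdd t
  rw [hd1] at h ⊢
  simpa using h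

open CutoffShooting in
/-- **Global shooting with cut-off, general form (uniqueness).**  Two `C²` solutions of `X″ t = B (X′ t) (g t (X t))`
(`g` jointly `C¹`) with the same Cauchy data at `0` coincide on `ℝ`. [folklore] -/
theorem cutoffShooting_unique {F : Type*} [NormedAddCommGroup F] [InnerProductSpace ℝ F] [ProperSpace F]
    (B : F →L[ℝ] F →L[ℝ] F) {g : ℝ → F → F}
    (hg : ContDiff ℝ 1 (fun q : ℝ × F => g q.1 q.2)) {X Y : ℝ → F} (hX : ContDiff ℝ 2 X) (hY : ContDiff ℝ 2 Y)
    (h0 : X 0 = Y 0) (h0' : deriv X 0 = deriv Y 0)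
    (hXo : ∀ t, deriv (deriv X) t = B (deriv X t) (g t (X t)))
    (hYo : ∀ t, deriv (deriv Y) t = B (deriv Y t) (g t (Y t))) : X = Y :=
  unique_of_phase hg hX hY h0 h0' hXo hYo

/-- **The cut-off local-induction equation on `ℝ³` (existence).**  For `c : ℝ → ℝ` and `F : ℝ → ℝ³ → ℝ³` with
`(t, y) ↦ c t • F t y` jointly `C¹` — e.g. `c = η χ` a smooth cut-off of the inverse local-induction coefficient and
`F t y = ½ y − α e₃ × y + U t` the frame drift plus a frozen forcing — and Cauchy data `(P, e)`, `‖e‖ = 1`, there is a global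
`C²` unit-speed curve `X : ℝ → ℝ³` with `X 0 = P`, `X′ 0 = e` and `X″ t = c t • X′ t × F t (X t)` for all `t`
(`iteratedDeriv 2` form). [folklore] -/
theorem cutoffLia_exists (c : ℝ → ℝ) (F : ℝ → EuclideanSpace ℝ (Fin 3) → EuclideanSpace ℝ (Fin 3))
    (hcF : ContDiff ℝ 1 (fun q : ℝ × EuclideanSpace ℝ (Fin 3) => c q.1 • F q.1 q.2))
    (P : EuclideanSpace ℝ (Fin 3)) {e : EuclideanSpace ℝ (Fin 3)} (he : ‖e‖ = 1) :
    ∃ X : ℝ → EuclideanSpace ℝ (Fin 3), ContDiff ℝ 2 X ∧ X 0 = P ∧ deriv X 0 = e ∧ (∀ t, ‖deriv X t‖ = 1) ∧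
      ∀ t, iteratedDeriv 2 X t = c t • cross (deriv X t) (F t (X t)) := by
  -- `⟪w × v, w⟫ = 0` (the tree's `DepletionLadder.inner_cross_curl_left`, re-derived inline to keep this file light)
  have hB : ∀ w v : EuclideanSpace ℝ (Fin 3), ⟪crossCLM w v, w⟫ = 0 := fun w v => by
    simp only [crossCLM_apply, cross, PiLp.inner_apply, RCLike.inner_apply, conj_trivial, Fin.sum_univ_three,
      crossProduct, LinearMap.mk₂_apply, Matrix.cons_val_zero, Matrix.cons_val_one,
      Matrix.cons_val_two, Matrix.head_cons, Matrix.tail_cons]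
    ring
  obtain ⟨X, hX, h0, h0', hunit, hode⟩ :=
    cutoffShooting_exists crossCLM hB (g := fun t y => c t • F t y) hcF P he
  refine ⟨X, hX, h0, h0', hunit, fun t => ?_⟩
  rw [iteratedDeriv_succ, iteratedDeriv_one, hode t, map_smul, crossCLM_apply]

/-- **The cut-off local-induction equation on `ℝ³` (uniqueness).**  Two `C²` curves with the same Cauchy data at `0`
solving `X″ t = c t • X′ t × F t (X t)` (`(t, y) ↦ c t • F t y` jointly `C¹`) coincide. [folklore] -/
theorem cutoffLia_unique (c : ℝ → ℝ) (F : ℝ → EuclideanSpace ℝ (Fin 3) → EuclideanSpace ℝ (Fin 3))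
    (hcF : ContDiff ℝ 1 (fun q : ℝ × EuclideanSpace ℝ (Fin 3) => c q.1 • F q.1 q.2))
    {X Y : ℝ → EuclideanSpace ℝ (Fin 3)} (hX : ContDiff ℝ 2 X) (hY : ContDiff ℝ 2 Y)
    (h0 : X 0 = Y 0) (h0' : deriv X 0 = deriv Y 0)
    (hXo : ∀ t, iteratedDeriv 2 X t = c t • cross (deriv X t) (F t (X t)))
    (hYo : ∀ t, iteratedDeriv 2 Y t = c t • cross (deriv Y t) (F t (Y t))) : X = Y := by
  have h2 : ∀ Z : ℝ → EuclideanSpace ℝ (Fin 3), iteratedDeriv 2 Z = deriv (deriv Z) :=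
    fun Z => by rw [iteratedDeriv_succ, iteratedDeriv_one]
  refine cutoffShooting_unique crossCLM (g := fun t y => c t • F t y) hcF hX hY h0 h0' (fun t => ?_) (fun t => ?_)
  · rw [← h2, hXo t, map_smul, crossCLM_apply]
  · rw [← h2, hYo t, map_smul, crossCLM_apply]

end SelectionBoxRJRung

end Summit.NavierStokesRegularity.NavierStokesRegularity.Theorems
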